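import Literature.AlgebraicGeometry.HodgeTheory.DiagonalSymmetryEigenHodgeNumbersAllDimensions
import Literature.AlgebraicGeometry.HodgeTheory.GriffithsResiduesPrimitive
import Literature.AlgebraicGeometry.HodgeTheory.BettiKunnethHodgeClassesAlgebraicClasses
import HarnessLib

/-!
# The hyperplane line of an even-dimensional smooth hypersurface is a Hodge line `ℂ·h^m ⊆ H^{m,m}`, and
# the invariant eigen-Hodge pieces of a diagonal symmetry below the Jacobian range
# (Voisin II §1.2.3 Cor. 1.24–1.25, §6.1.3; Voisin I Prop. 11.20)

Family `hodge`, layer `Literature/AlgebraicGeometry/HodgeTheory`. PROOF FILE (theorems only; no definition,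
no named fact). First of two sequels of `DiagonalSymmetryEigenHodgeNumbersAllDimensions` treating the
INVARIANT eigenvalue `μ = 1` of a diagonal symmetry `σ_a` of a smooth hypersurface `Y = V₊(F) ⊂ ℙ^{2m+1}`
of EVEN dimension `n = 2m` (that file's `-- TODO(general form)`), using the primitivity clause of the
residue package (`GriffithsResiduesPrimitive`):

* `hyperplaneClasses_le_F_and_disjoint_and_finrank` — the line `L = β⁻¹(ι^*H^{2m}(ℙ^{2m+1}(ℂ); ℂ))`
  satisfies `L ⊆ F^m`, `L ∩ F^{m+1} = 0`, `dim L = 1`: it is spanned by the RATIONAL class `h^m|_Y`, which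
  is algebraic (`range_map_projectiveSpace_le_algebraicClasses`), hence a Hodge class of type `(m,m)`
  (`span_preimage_ofRatClass_algebraicClasses_le_hodgeClasses_hodge`, Voisin I Prop. 11.20), and non-zero
  (`ι^*` is injective on `H^{2m}(ℙ^{2m+1})`, `map_ne_zero_of_le`, Voisin II Cor. 1.25).
* `finrank_eigenspace_one_inf_piece_eq_of_lt_of_residues_primitive` — below the Jacobian range
  (`(q + 1) d < n + 2`): `dim_ℂ (ker(σ_a^* ⊗ ℂ − 1) ∩ H^{n−q,q}(Y)) = [q = m]` (clause (ii) with no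
  numerator degree leaves `F^{n−q} ⊆ L`).

The companion `DiagonalSymmetryInvariantEigenHodgeNumbers` does the Jacobian range. Written by the prover
seat `hodge-nonav-prover-Bx` (cell `hodge-nonav`) towards the derivation of the named fact
`voisin2003_finrank_eigenspace_inf_hodgePiece_of_diagonalStabilizer` (binder `stub_voisinEigenHodgeNumbers` of
crux K1-B of `Summits/HodgeConjecture/HodgeConjecture/Theses/SignSymmetricPowers.lean`) from
`Griffiths1969_residues_primitive`.

## References
* [VoisinHodgeII2003] C. Voisin, Hodge Theory and Complex Algebraic Geometry II, CUP 2003, §1.2.3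
  Cor. 1.24–1.25; §6.1.3 (`α_p`), Cor. 6.12 (held text chunks p0159, p0161).
* [VoisinHodgeI2002] C. Voisin, Hodge Theory and Complex Algebraic Geometry I, §11.1.2 Prop. 11.20.
* [CarlsonToledo1999] J. A. Carlson, D. Toledo, Duke Math. J. 97 (1999), §2 (held text p0005).
-/

noncomputable section

open CategoryTheory AlgebraicGeometry MvPolynomial
open scoped TensorProduct

namespace Literature.AlgebraicGeometry.HodgeTheory

open Literature.AlgebraicGeometry.Motives Literature.AlgebraicTopology.SingularHomology
open Literature.RingTheory.MvPolynomial (idealDegree mem_idealDegree)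
open Literature.Geometry.Kaehler (lefschetzOperator)

section HodgeTheory

variable {n d : ℕ} {F : MvPolynomial (Fin (n + 2)) ℂ}

/-- `v ↦ 1 ⊗ v` is injective (`ℚ → ℂ` injective, `V` flat over `ℚ`). [folklore] -/
private theorem ofRat_injective' {V : Type*} [AddCommGroup V] [Module ℚ V] :
    Function.Injective (HodgeStructure.ofRat : V →ₗ[ℚ] ℂ ⊗[ℚ] V) := by
  have h := Module.Flat.rTensor_preserves_injective_linearMap (M := V) (Algebra.linearMap ℚ ℂ)
    (algebraMap ℚ ℂ).injective
  intro v w hvw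
  have : (Algebra.linearMap ℚ ℂ).rTensor V ((TensorProduct.lid ℚ V).symm v) =
      (Algebra.linearMap ℚ ℂ).rTensor V ((TensorProduct.lid ℚ V).symm w) := by
    simpa [HodgeStructure.ofRat_apply] using hvw
  exact (TensorProduct.lid ℚ V).symm.injective (h this)

/-! ### §1 The line of hyperplane classes in even dimension: `L ⊆ H^{m,m}`, `dim L = 1` -/

/-- **The hyperplane line of an even-dimensional smooth hypersurface sits in `H^{m,m}`**: for
`Y = V₊(F) ⊂ ℙ^{2m+1}` (`F` irreducible, homogeneous of degree `d`), the line
`L = β⁻¹(ι^* H^{2m}(ℙ^{2m+1}(ℂ); ℂ))` satisfies `L ⊆ F^m H^{2m}(Y)`, `L ∩ F^{m+1} = 0` and `dim_ℂ L = 1`: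
`L` is spanned by the rational class `h^m|_Y`, which is ALGEBRAIC (`range_map_projectiveSpace_le_algebraicClasses`),
hence a Hodge class of type `(m,m)` (`span_preimage_ofRatClass_algebraicClasses_le_hodgeClasses_hodge`), and
non-zero (`ι^*` is injective on `H^{2m}(ℙ^{2m+1})`, `map_ne_zero_of_le`).
[cite: VoisinHodgeII2003, §1.2.3 Cor. 1.24–1.25] [cite: VoisinHodgeI2002, §11.1.2 Prop. 11.20] -/
theorem hyperplaneClasses_le_F_and_disjoint_and_finrank (hHD : exists_isReal_hodgeModel)
    (hX : IsSmoothProjective n (SmoothHypersurface.hypersurface F)) (hF : F.IsHomogeneous d)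
    (hirr : Irreducible F) {m : ℕ} (hnm : n = 2 * m) :
    (LinearMap.range (complexBetti.map (SmoothHypersurface.hypersurfaceι F) n).hom).map
        (ofRatClassBaseChangeEquiv hX n).symm.toLinearMap ≤ (BettiUniverse.hodge hHD hX n).F m ∧
      (LinearMap.range (complexBetti.map (SmoothHypersurface.hypersurfaceι F) n).hom).map
          (ofRatClassBaseChangeEquiv hX n).symm.toLinearMap ⊓
        (BettiUniverse.hodge hHD hX n).F (m + 1) = ⊥ ∧
      Module.finrank ℂ ↥((LinearMap.range (complexBetti.map (SmoothHypersurface.hypersurfaceι F) n).hom).map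
        (ofRatClassBaseChangeEquiv hX n).symm.toLinearMap) = 1 := by
  subst hnm
  classical
  set X := SmoothHypersurface.hypersurface F with hXdef
  set ι := SmoothHypersurface.hypersurfaceι F with hιdef
  set H := BettiUniverse.hodge hHD hX (2 * m) with hHdef
  set β := ofRatClassBaseChangeEquiv hX (2 * m) with hβ
  set L : Submodule ℂ (ℂ ⊗[ℚ] ↥(bettiCohomology X (2 * m))) :=
    (LinearMap.range (complexBetti.map ι (2 * m)).hom).map β.symm.toLinearMap with hLdef
  haveI : Module.Finite ℚ ↥(bettiCohomology X (2 * m)) := BettiUniverse.finite hX (2 * m)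
  -- `ι^*` is injective on `H^{2m}(ℙ^{2m+1}(ℂ); ℂ) ≅ ℂ`
  have hinj : Function.Injective (complexBetti.map ι (2 * m)).hom := by
    refine (injective_iff_map_eq_zero _).mpr fun α hα ↦ ?_
    by_contra hα0
    exact map_ne_zero_of_le hX hF hirr inferInstance ι (SmoothHypersurface.range_hypersurfaceι _)
      (p := m) (by omega) hα0 hα
  have hfin : Module.finrank ℂ ↥L = 1 := by
    rw [hLdef, LinearEquiv.finrank_map_eq, LinearMap.finrank_range_of_inj hinj]
    exact finrank_complexBetti_projectiveSpace_two_mul (2 * m + 1) (k := m) (by omega)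
  -- a non-zero RATIONAL class `c₀` on `ℙ^{2m+1}` in degree `2m`
  have hP := isSmoothProjective_projectiveSpace_holds ℂ (2 * m + 1)
  haveI : Module.Finite ℚ ↥(bettiCohomology (projectiveSpace (2 * m + 1) ℂ) (2 * m)) := BettiUniverse.finite hP _
  obtain ⟨c₀, hc₀⟩ : ∃ c₀ : ↥(bettiCohomology (projectiveSpace (2 * m + 1) ℂ) (2 * m)), c₀ ≠ 0 := by
    by_contra hno
    push Not at hno
    have h1 := finrank_complexBetti_projectiveSpace_two_mul (2 * m + 1) (k := m) (by omega)
    have h0 : Module.finrank ℂ (complexBetti (projectiveSpace (2 * m + 1) ℂ) (2 * m)) = 0 := by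
      rw [← (ofRatClassBaseChangeEquiv hP (2 * m)).finrank_eq, Module.finrank_baseChange]
      haveI : Subsingleton ↥(bettiCohomology (projectiveSpace (2 * m + 1) ℂ) (2 * m)) :=
        ⟨fun a b ↦ by rw [hno a, hno b]⟩
      exact Module.finrank_zero_of_subsingleton
    omega
  -- its pull-back `v₀ = ι^* c₀`, a rational algebraic, hence Hodge, class
  set fι := (singularCohomology.map ℚ ℚ (Motives.AlgPoints.mapContinuous (L := ℂ) ι) (2 * m)).hom with hfι
  set v₀ : ↥(bettiCohomology X (2 * m)) := fι c₀ with hv₀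
  have hβv₀ : β (HodgeStructure.ofRat v₀) = (complexBetti.map ι (2 * m)).hom
      (ofRatClass (Motives.ComplexPoints (projectiveSpace (2 * m + 1) ℂ)) (2 * m) c₀) := by
    have h := HodgeModel.ofRatClassBaseChange_baseChange_map ι (2 * m) (HodgeStructure.ofRat c₀)
    rw [ofRatClassBaseChange_ofRat] at h
    rw [hβ, ofRatClassBaseChangeEquiv_apply, ← h, hv₀, hfι, HodgeStructure.ofRat_apply,
      HodgeStructure.ofRat_apply, LinearMap.baseChange_tmul]
  have hv₀L : HodgeStructure.ofRat v₀ ∈ L := by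
    refine Submodule.mem_map.mpr ⟨β (HodgeStructure.ofRat v₀), ?_, β.symm_apply_apply _⟩
    rw [hβv₀]; exact LinearMap.mem_range_self _ _
  have hv₀ne : HodgeStructure.ofRat v₀ ≠ 0 := by
    intro h0
    have h1 : (complexBetti.map ι (2 * m)).hom
        (ofRatClass (Motives.ComplexPoints (projectiveSpace (2 * m + 1) ℂ)) (2 * m) c₀) = 0 := by
      rw [← hβv₀, h0, map_zero]
    have h2 := hinj (by rw [h1, map_zero] : (complexBetti.map ι (2 * m)).hom _ = (complexBetti.map ι (2 * m)).hom 0)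
    rw [← ofRatClassBaseChange_ofRat] at h2
    have h3 := ofRatClassBaseChange_injective (Motives.ComplexPoints (projectiveSpace (2 * m + 1) ℂ)) (2 * m)
      (by rw [h2, map_zero] : ofRatClassBaseChange _ (2 * m) (HodgeStructure.ofRat c₀) =
        ofRatClassBaseChange _ (2 * m) 0)
    exact hc₀ (ofRat_injective' (by rw [h3, map_zero]))
  have hv₀alg : v₀ ∈ Submodule.span ℚ (ofRatClass (Motives.ComplexPoints X) (2 * m) ⁻¹'
      (algebraicClasses X m : Set (complexBetti X (2 * m)))) := by
    refine Submodule.subset_span ?_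
    rw [Set.mem_preimage, SetLike.mem_coe, ← ofRatClassBaseChange_ofRat, ← ofRatClassBaseChangeEquiv_apply hX,
      ← hβ, hβv₀]
    exact range_map_projectiveSpace_le_algebraicClasses hX ι m (LinearMap.mem_range_self _ _)
  have hv₀F : HodgeStructure.ofRat v₀ ∈ H.F m :=
    (H.mem_hodgeClasses_iff m v₀).mp
      (BettiUniverse.span_preimage_ofRatClass_algebraicClasses_le_hodgeClasses_hodge hHD hX m hv₀alg)
  have hv₀piece : HodgeStructure.ofRat v₀ ∈ H.piece m m :=
    H.ofRat_mem_piece_of_mem_hodgeClasses (by push_cast; ring)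
      (BettiUniverse.span_preimage_ofRatClass_algebraicClasses_le_hodgeClasses_hodge hHD hX m hv₀alg)
  -- `L = ℂ • ofRat v₀`
  have hLspan : L = Submodule.span ℂ {HodgeStructure.ofRat v₀} := by
    symm
    refine Submodule.eq_of_le_of_finrank_le ((Submodule.span_singleton_le_iff_mem _ _).mpr hv₀L) ?_
    rw [hfin, finrank_span_singleton hv₀ne]
  refine ⟨?_, ?_, hfin⟩
  · rw [hLspan, Submodule.span_singleton_le_iff_mem]
    exact hv₀F
  · rw [eq_bot_iff]
    rintro x ⟨hxL, hxF⟩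
    rw [SetLike.mem_coe, hLspan, Submodule.mem_span_singleton] at hxL
    obtain ⟨t, rfl⟩ := hxL
    by_cases ht : t = 0
    · rw [ht, zero_smul]; exact Submodule.zero_mem _
    exfalso
    have hmem : HodgeStructure.ofRat v₀ ∈ H.F (m + 1) := by
      have := (H.F ((m : ℤ) + 1)).smul_mem t⁻¹ hxF
      rwa [smul_smul, inv_mul_cancel₀ ht, one_smul] at this
    have hbot := H.piece_inf_F_succ_sup_complexConj_eq_bot m
    have hmm : ((2 * m : ℕ) : ℤ) - m = m := by push_cast; ring
    rw [hmm] at hbot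
    have : HodgeStructure.ofRat v₀ ∈ H.piece m m ⊓ (H.F (m + 1) ⊔
        HodgeStructure.complexConj (H.F ((m : ℤ) + 1))) :=
      ⟨hv₀piece, Submodule.mem_sup_left hmem⟩
    rw [hbot, Submodule.mem_bot] at this
    exact hv₀ne this

/-! ### §2 The invariant eigen-Hodge pieces below the Jacobian range -/

/-- **Below the Jacobian range the invariant eigen-Hodge piece is the hyperplane line**, even dimension
`n = 2m ≥ 2`: if `(q + 1) d < n + 2` then `dim_ℂ (ker(σ_a^* ⊗ ℂ − 1) ∩ H^{n−q,q}(Y)) = [q = m]` — clause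
(ii) with an empty set of numerator degrees leaves `F^{n−q} ⊆ L`, and `L ⊆ H^{m,m}` is `σ_a^*`-invariant.
[cite: VoisinHodgeII2003, §6.1.3 (α_p) and Cor. 6.12 (held text chunks p0159, p0161)]
[cite: CarlsonToledo1999, §2 (held text p0005)] -/
theorem finrank_eigenspace_one_inf_piece_eq_of_lt_of_residues_primitive
    (hG : Griffiths1969_residues_primitive)
    (hHD : exists_isReal_hodgeModel) (hI : hodgePQ_independent_of_hodgeModel)
    {m : ℕ} (hnm : n = 2 * m) (hm : 1 ≤ m) (hF : F.IsHomogeneous d) (hirr : Irreducible F)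
    (hJ : ∀ z : Fin (n + 2) → ℂ, z ≠ 0 → MvPolynomial.eval z F = 0 →
      ∃ j, MvPolynomial.eval z (MvPolynomial.pderiv j F) ≠ 0)
    (hX : IsSmoothProjective n (SmoothHypersurface.hypersurface F))
    {a : Fin (n + 2) → ℂˣ} (ha : a ∈ diagonalStabilizer F)
    {q : ℕ} (hq : q ≤ n) (hlt : (q + 1) * d < n + 2) :
    Module.finrank ℂ ↥(Module.End.eigenspace ((BettiUniverse.pull (diagonalAut F ha) n).baseChange ℂ) 1 ⊓
        (BettiUniverse.hodge hHD hX n).piece ((n : ℤ) - q) q) = if q = m then 1 else 0 := by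
  classical
  have hn1 : 1 ≤ n := by omega
  set X := SmoothHypersurface.hypersurface F with hXdef
  set ι := SmoothHypersurface.hypersurfaceι F with hιdef
  set A := BettiUniverse.realHodgeModel hHD hX with hAdef
  set H := BettiUniverse.hodge hHD hX n with hHdef
  set gC := (BettiUniverse.pull (diagonalAut F ha) n).baseChange ℂ with hgC
  obtain ⟨res, hpack⟩ := hG n d hn1 F hF hJ hX A
  have h2 := hpack.span
  set β := ofRatClassBaseChangeEquiv hX n with hβ
  set L : Submodule ℂ (ℂ ⊗[ℚ] ↥(bettiCohomology X n)) :=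
    (LinearMap.range (complexBetti.map ι n).hom).map β.symm.toLinearMap with hLdef
  have hl1 : 1 ≤ q + 1 := Nat.le_add_left 1 q
  have hln : q + 1 ≤ n + 1 := Nat.add_le_add_right hq 1
  haveI : Module.Finite ℚ ↥(bettiCohomology X n) := BettiUniverse.finite hX n
  obtain ⟨hLF, hLF1, hLdim⟩ := hyperplaneClasses_le_F_and_disjoint_and_finrank hHD hX hF hirr hnm
  have memF : ∀ (j : ℕ) (x : ℂ ⊗[ℚ] ↥(bettiCohomology X n)),
      x ∈ H.F (j : ℤ) ↔ A.pullback n (β x) ∈ A.hodgeFiltration n j := by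
    intro j x
    rw [hHdef, BettiUniverse.hodge_F, HodgeModel.mem_ratF_iff, Int.toNat_natCast]
    rfl
  have hidx1 : n + 1 - (q + 1) = n - q := by omega
  have hp : ((n - q : ℕ) : ℤ) = (n : ℤ) - q := by omega
  -- the hyperplane classes are invariant
  have hL1 : ∀ y ∈ L, gC y = y := fun y hy ↦
    baseChange_pull_diagonalAut_eq_self_of_mem_hyperplaneClasses hX ha n hy
  -- (ii') with no numerator degree: `F^{n-q} ⊆ L`
  have hFL : H.F ((n : ℤ) - q) ≤ L := by
    intro x hx
    rw [← hp, memF, ← hidx1] at hx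
    have h2x := h2 (q + 1) hl1 hln (β x) hx
    have hsup : (⨆ (k' : ℕ) (_ : k' + (n + 2) = (q + 1) * d),
        (homogeneousSubmodule (Fin (n + 2)) ℂ k').map (res (q + 1))) = ⊥ :=
      le_bot_iff.mp (iSup_le fun k' ↦ iSup_le fun hk' ↦ by omega)
    rw [hsup, bot_sup_eq] at h2x
    have : x = β.symm (β x) := (β.symm_apply_apply x).symm
    rw [this]
    exact Submodule.mem_map_of_mem h2x
  have hFL1 : H.F ((n : ℤ) - q + 1) ≤ L := (H.antitone_F (by omega)).trans hFL
  -- `E_1 ∩ F^p = L ∩ F^p` for `p = n - q, n - q + 1`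
  have hEF : ∀ p : ℤ, H.F p ≤ L → Module.End.eigenspace gC 1 ⊓ H.F p = L ⊓ H.F p := by
    intro p hpL
    refine le_antisymm (fun x hx ↦ ⟨hpL hx.2, hx.2⟩) (fun x hx ↦ ⟨?_, hx.2⟩)
    rw [SetLike.mem_coe, Module.End.mem_eigenspace_iff, one_smul]
    exact hL1 x hx.1
  -- (X4)
  have hpiece : H.F ((n : ℤ) - q) = H.F ((n : ℤ) - q + 1) ⊔ H.piece ((n : ℤ) - q) q := by
    have h := Motives.HodgeStructure.F_eq_F_succ_sup_piece H ((n : ℤ) - q)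
    rwa [show (n : ℤ) - ((n : ℤ) - q) = q by ring] at h
  have hdisj : Disjoint (H.F ((n : ℤ) - q + 1)) (H.piece ((n : ℤ) - q) q) := by
    rw [disjoint_iff, inf_comm]
    have h := Motives.HodgeStructure.piece_inf_F_succ_sup_complexConj_eq_bot H ((n : ℤ) - q)
    rw [show (n : ℤ) - ((n : ℤ) - q) = q by ring] at h
    refine le_bot_iff.mp (le_trans (inf_le_inf_left _ le_sup_left) h.le)
  set gH := BettiUniverse.pullHodgeHom hHD hI hX hX (diagonalAut F ha) n with hgH
  have hgH' : gH.toLinearMap.baseChange ℂ = gC := by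
    rw [hgH, BettiUniverse.pullHodgeHom_toLinearMap]
  have hstabF : ∀ x ∈ H.F ((n : ℤ) - q + 1), gC x ∈ H.F ((n : ℤ) - q + 1) := fun x hx ↦ by
    rw [← hgH']; exact gH.baseChange_mem_F _ hx
  have hstabW : ∀ x ∈ H.piece ((n : ℤ) - q) q, gC x ∈ H.piece ((n : ℤ) - q) q := fun x hx ↦ by
    rw [← hgH']; exact gH.baseChange_mem_piece hx
  have X4 := finrank_eigenspace_inf_sup_eq_of_disjoint gC hdisj hstabF hstabW 1
  rw [← hpiece, hEF _ hFL, hEF _ hFL1] at X4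
  -- the hyperplane line in the filtration
  have hLle : ∀ p : ℤ, p ≤ m → L ⊓ H.F p = L := fun p hpm ↦
    inf_eq_left.mpr (hLF.trans (H.antitone_F hpm))
  have hLbot : ∀ p : ℤ, (m : ℤ) + 1 ≤ p → L ⊓ H.F p = ⊥ := fun p hpm ↦
    le_bot_iff.mp (le_trans (inf_le_inf_left _ (H.antitone_F hpm)) hLF1.le)
  have hLq : Module.finrank ℂ ↥(L ⊓ H.F ((n : ℤ) - q)) = if m ≤ q then 1 else 0 := by
    split_ifs with hmq
    · rw [hLle _ (by omega), hLdim]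
    · rw [hLbot _ (by omega), finrank_bot]
  have hLq1 : Module.finrank ℂ ↥(L ⊓ H.F ((n : ℤ) - q + 1)) = if m + 1 ≤ q then 1 else 0 := by
    split_ifs with hmq
    · rw [hLle _ (by omega), hLdim]
    · rw [hLbot _ (by omega), finrank_bot]
  have d1 : Module.finrank ℂ ↥(L ⊓ H.F ((n : ℤ) - q)) = Module.finrank ℂ ↥(L ⊓ H.F ((n : ℤ) - q + 1)) +
      Module.finrank ℂ ↥(Module.End.eigenspace gC 1 ⊓ H.piece ((n : ℤ) - q) q) := X4
  have d6 : Module.finrank ℂ ↥(L ⊓ H.F ((n : ℤ) - q)) = if m ≤ q then 1 else 0 := hLq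
  have d7 : Module.finrank ℂ ↥(L ⊓ H.F ((n : ℤ) - q + 1)) = if m + 1 ≤ q then 1 else 0 := hLq1
  clear X4 hLq hLq1
  by_cases hqm : q = m
  · rw [if_pos hqm]
    rw [if_pos (by omega)] at d6
    rw [if_neg (by omega)] at d7
    omega
  · rw [if_neg hqm]
    by_cases hmq : m ≤ q
    · rw [if_pos hmq] at d6
      rw [if_pos (by omega)] at d7
      omega
    · rw [if_neg hmq] at d6
      rw [if_neg (by omega)] at d7
      omega


end HodgeTheory

end Literature.AlgebraicGeometry.HodgeTheory

end
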